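import Summits.CriticalPhenomena.CardyFormulaZ2.Theorems.CardyAnchoredRigidityClusterSetConnected
import Summits.CriticalPhenomena.CardyFormulaZ2.Theorems.CardyTensorRGPolyominoGaussianLawStubScalingIdentity
import Literature.Probability.RandomPlanarGeometry.ZoomFlow
import HarnessLib

/-!
# Stub A of line `dilation-dynamics` (crux `CardyShadowIsolated`, stmt-CriticalPhenomena-5767):
# the dilation flow on the cluster set `Λ'`

The scale action `(scaleAct s g)(R) = g (e^s • R)` of the additive reals on crossing functions
`ConformalRectangle → ℝ` restricts to a jointly continuous flow (`Mathlib.Dynamics.Flow`) on the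
cluster set `Λ'` at `0⁺` of the bond-`ℤ²` crossing-function path
`δ ↦ (R ↦ bondDomainCrossingProb R δ)`:

* invariance of `Λ'` — exact scale covariance of the discretisation
  (`PolyominoGaussianLaw.Birth.stub_scalingIdentity`, proved in the tree):
  `bondDomainCrossingProb (e^s • R) δ = bondDomainCrossingProb R (e^{-s} δ)`, so the action moves
  the path along itself and preserves its cluster points;
* the group law — functoriality of `MarkedDomain.map` (`map_map`, `map_refl`) and `e^{s+t} = e^s e^t`;
* JOINT continuity on `ℝ × Λ'` — equicontinuity of cluster points along dilations: by the proved
  support item `ScaleContinuity` (`ClusterSetConnected.scaleContinuity`) and exact covariance,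
  `|g (e^u • R) - g R| ≤ ε` for every `g ∈ Λ'` once `|u| < log (1 + θ(R, ε))`, because
  `(g (e^u • R), g R)` is a cluster value of `(p_R(e^{-u} δ), p_R(δ))` as `δ → 0⁺`.

The objects `clusterSet`, `dilation`, `scaleAct` are the definitions of
`Cruxes/CardyShadowIsolated/Lines/dilation_dynamics.lean` repeated verbatim (workfiles are not
importable), so that `stub_dilationFlow` below is the registered stub by name and signature.
No sorry, no named fact.
-/

noncomputable section

namespace Summit.CriticalPhenomena.CardyFormulaZ2.Theorems.CardyShadowIsolated.DilationDynamics

open Set Filter Topology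
open Literature.Probability.RandomPlanarGeometry Literature.Probability.Percolation

/-! ### Objects (verbatim from the line file) -/

/-- The cluster set `Λ'` at `0⁺` of the crossing-function path (product topology); literally the
set of the crux / of `ClusterSetConnected`. [folklore] -/
def clusterSet : Set (ConformalRectangle → ℝ) :=
  {g | MapClusterPt g (nhdsWithin (0 : ℝ) (Set.Ioi 0))
    (fun (δ : ℝ) (R : ConformalRectangle) => bondDomainCrossingProb R δ)}

/-- `e^s ≠ 0` in `ℂ`. [folklore] -/
theorem exp_ofReal_ne_zero (s : ℝ) : ((Real.exp s : ℝ) : ℂ) ≠ 0 :=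
  Complex.ofReal_ne_zero.2 (Real.exp_pos s).ne'

/-- The dilation `z ↦ e^s z` of the plane, in log-scale parametrisation `s ∈ ℝ`. [folklore] -/
def dilation (s : ℝ) : ℂ ≃ₜ ℂ :=
  Homeomorph.mulLeft₀ ((Real.exp s : ℝ) : ℂ) (exp_ofReal_ne_zero s)

/-- Pointwise formula for `dilation`. [folklore] -/
@[simp] theorem dilation_apply (s : ℝ) (z : ℂ) : dilation s z = ((Real.exp s : ℝ) : ℂ) * z := rfl

/-- The coercion of `dilation s` is multiplication by `e^s`. [folklore] -/
theorem coe_dilation (s : ℝ) : (⇑(dilation s) : ℂ → ℂ) = fun z : ℂ => ((Real.exp s : ℝ) : ℂ) * z :=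
  rfl

/-- The scale action of log-scale `s` on crossing functions: evaluate on the `e^s`-dilate.
[cite: SchrammSmirnov2011, §1] -/
def scaleAct (s : ℝ) (g : ConformalRectangle → ℝ) : ConformalRectangle → ℝ :=
  fun R => g (R.map (dilation s))

/-! ### The group law of the dilations on marked domains -/

/-- `dilation 0` is the identity. [folklore] -/
theorem dilation_zero : dilation 0 = Homeomorph.refl ℂ :=
  Homeomorph.ext fun z => by simp [dilation_apply]

/-- `dilation s` followed by `dilation t` is `dilation (t + s)` (`e^t (e^s z) = e^{t+s} z`). [folklore] -/
theorem dilation_trans (s t : ℝ) : (dilation s).trans (dilation t) = dilation (t + s) :=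
  Homeomorph.ext fun z => by
    simp only [Homeomorph.trans_apply, dilation_apply, Real.exp_add, Complex.ofReal_mul]
    ring

/-- Dilating a marked domain by `e^0` does nothing. [folklore] -/
theorem map_dilation_zero (R : ConformalRectangle) : R.map (dilation 0) = R := by
  rw [dilation_zero, MarkedDomain.map_refl]

/-- Dilating by `e^s` and then by `e^t` is dilating by `e^{t+s}`. [folklore] -/
theorem map_dilation_map_dilation (R : ConformalRectangle) (s t : ℝ) :
    (R.map (dilation s)).map (dilation t) = R.map (dilation (t + s)) := by
  rw [MarkedDomain.map_map, dilation_trans]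

/-- The scale action at `0` is the identity. [folklore] -/
theorem scaleAct_zero (g : ConformalRectangle → ℝ) : scaleAct 0 g = g := by
  funext R
  simp only [scaleAct, map_dilation_zero]

/-- The scale action is an action: `scaleAct (s + t) = scaleAct s ∘ scaleAct t`. [folklore] -/
theorem scaleAct_add (s t : ℝ) (g : ConformalRectangle → ℝ) :
    scaleAct (s + t) g = scaleAct s (scaleAct t g) := by
  funext R
  simp only [scaleAct, map_dilation_map_dilation, add_comm t s]

/-! ### Exact covariance and invariance of `Λ'` -/

/-- **Exact scale covariance** of the `ℤ²` crossing probabilities of conformal rectangles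
(tree `stub_scalingIdentity`). [folklore] -/
theorem bondDomainCrossingProb_map_dilation (R : ConformalRectangle) (s δ : ℝ) :
    bondDomainCrossingProb (R.map (dilation s)) δ = bondDomainCrossingProb R (Real.exp (-s) * δ) := by
  have key := Summit.CriticalPhenomena.CardyFormulaZ2.Cruxes.PolyominoGaussianLaw.Birth.stub_scalingIdentity
    R.carrier (R.arc 0) (R.arc 2) (Real.exp (-s) * δ) (Real.exp s) (Real.exp_pos s)
  have hmul : Real.exp s * (Real.exp (-s) * δ) = δ := by
    rw [← mul_assoc, ← Real.exp_add, add_neg_cancel, Real.exp_zero, one_mul]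
  rw [hmul] at key
  unfold bondDomainCrossingProb
  rw [MarkedDomain.carrier_map, MarkedDomain.arc_map, MarkedDomain.arc_map, coe_dilation]
  exact key

/-- The scale action by `s` is continuous on the product space. [folklore] -/
theorem continuous_scaleAct (s : ℝ) : Continuous (scaleAct s) :=
  continuous_pi fun R => continuous_apply (R.map (dilation s))

/-- **`Λ'` is invariant under every dilation.** [cite: SchrammSmirnov2011, §1] -/
theorem scaleAct_mem_clusterSet {g : ConformalRectangle → ℝ} (hg : g ∈ clusterSet) (s : ℝ) :
    scaleAct s g ∈ clusterSet := by
  have h1 : MapClusterPt (scaleAct s g) (nhdsWithin (0 : ℝ) (Set.Ioi 0))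
      (scaleAct s ∘ fun (δ : ℝ) (R : ConformalRectangle) => bondDomainCrossingProb R δ) :=
    hg.continuousAt_comp (continuous_scaleAct s).continuousAt
  have h2 : (scaleAct s ∘ fun (δ : ℝ) (R : ConformalRectangle) => bondDomainCrossingProb R δ) =
      (fun (δ : ℝ) (R : ConformalRectangle) => bondDomainCrossingProb R δ) ∘
        fun δ : ℝ => Real.exp (-s) * δ := by
    funext δ R
    exact bondDomainCrossingProb_map_dilation R s δ
  rw [h2] at h1
  have hc : 0 < Real.exp (-s) := Real.exp_pos _
  have ht : Tendsto (fun δ : ℝ => Real.exp (-s) * δ) (nhdsWithin (0 : ℝ) (Set.Ioi 0))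
      (nhdsWithin (0 : ℝ) (Set.Ioi 0)) := by
    refine tendsto_nhdsWithin_of_tendsto_nhds_of_eventually_within _ ?_ ?_
    · have : Tendsto (fun δ : ℝ => Real.exp (-s) * δ) (𝓝 0) (𝓝 (Real.exp (-s) * 0)) :=
        (continuous_const.mul continuous_id).tendsto 0
      rw [mul_zero] at this
      exact this.mono_left nhdsWithin_le_nhds
    · filter_upwards [self_mem_nhdsWithin] with δ hδ
      exact mul_pos hc hδ
  exact MapClusterPt.of_comp ht h1

/-! ### Equicontinuity of cluster points along dilations -/

/-- **Equicontinuity along dilations** (from `scaleContinuity` and exact covariance): for every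
conformal rectangle `R` and `ε > 0` there is `η > 0` such that EVERY cluster point `g ∈ Λ'`
satisfies `|g (e^u • R) - g R| ≤ ε` whenever `|u| < η`. [cite: SchrammSmirnov2011, §1] -/
theorem clusterSet_equicontinuous (R : ConformalRectangle) {ε : ℝ} (hε : 0 < ε) :
    ∃ η > (0 : ℝ), ∀ g ∈ clusterSet, ∀ u : ℝ, |u| < η → |g (R.map (dilation u)) - g R| ≤ ε := by
  obtain ⟨θ, hθ, δ₀, hδ₀, H⟩ :=
    Summit.CriticalPhenomena.CardyFormulaZ2.Theorems.ClusterSetConnected.scaleContinuity R ε hε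
  refine ⟨Real.log (1 + θ), Real.log_pos (by linarith), fun g hg u hu => ?_⟩
  -- `(g (e^u • R), g R)` is a cluster value of `(p_R(e^{-u} δ), p_R(δ))`
  set ev : (ConformalRectangle → ℝ) → ℝ × ℝ := fun h => (h (R.map (dilation u)), h R) with hev
  have hevc : Continuous ev :=
    (continuous_apply (R.map (dilation u))).prodMk (continuous_apply R)
  have h1 : MapClusterPt (ev g) (nhdsWithin (0 : ℝ) (Set.Ioi 0))
      (ev ∘ fun (δ : ℝ) (R : ConformalRectangle) => bondDomainCrossingProb R δ) :=
    hg.continuousAt_comp hevc.continuousAt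
  have h2 : (ev ∘ fun (δ : ℝ) (R : ConformalRectangle) => bondDomainCrossingProb R δ) =
      fun δ : ℝ => (bondDomainCrossingProb R (Real.exp (-u) * δ), bondDomainCrossingProb R δ) := by
    funext δ
    simp only [hev, Function.comp_apply, bondDomainCrossingProb_map_dilation]
  rw [h2] at h1
  -- eventually the pair lies in the closed set `{(a, b) | |a - b| ≤ ε}`
  have hexpu : Real.exp |u| < 1 + θ := by
    calc Real.exp |u| < Real.exp (Real.log (1 + θ)) := Real.exp_lt_exp.2 hu
      _ = 1 + θ := Real.exp_log (by linarith)
  have hD : IsClosed {q : ℝ × ℝ | |q.1 - q.2| ≤ ε} :=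
    isClosed_le (continuous_abs.comp (continuous_fst.sub continuous_snd)) continuous_const
  have hev_mem : ∀ᶠ δ in nhdsWithin (0 : ℝ) (Set.Ioi 0),
      (bondDomainCrossingProb R (Real.exp (-u) * δ), bondDomainCrossingProb R δ) ∈
        {q : ℝ × ℝ | |q.1 - q.2| ≤ ε} := by
    have hsmall : Set.Ioo 0 (δ₀ * Real.exp (-|u|)) ∈ nhdsWithin (0 : ℝ) (Set.Ioi 0) :=
      Ioo_mem_nhdsGT (mul_pos hδ₀ (Real.exp_pos _))
    filter_upwards [hsmall] with δ hδ
    have hδpos : 0 < δ := hδ.1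
    have hδlt : δ < δ₀ * Real.exp (-|u|) := hδ.2
    have hele1 : Real.exp (-|u|) ≤ 1 := by
      rw [Real.exp_le_one_iff]; exact neg_nonpos.2 (abs_nonneg u)
    have hδδ₀ : δ < δ₀ := by
      calc δ < δ₀ * Real.exp (-|u|) := hδlt
        _ ≤ δ₀ * 1 := by gcongr
        _ = δ₀ := mul_one _
    have hcpos : 0 < Real.exp (-u) := Real.exp_pos _
    show |bondDomainCrossingProb R (Real.exp (-u) * δ) - bondDomainCrossingProb R δ| ≤ ε
    rcases le_or_gt 0 u with hu0 | hu0
    · -- `e^{-u} δ ≤ δ`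
      have habs : |u| = u := abs_of_nonneg hu0
      have hle : Real.exp (-u) * δ ≤ δ := by
        have : Real.exp (-u) ≤ 1 := by rw [Real.exp_le_one_iff]; linarith
        nlinarith
      have hratio : δ ≤ (1 + θ) * (Real.exp (-u) * δ) := by
        have h1' : Real.exp u < 1 + θ := by rw [habs] at hexpu; exact hexpu
        have : δ = Real.exp u * (Real.exp (-u) * δ) := by
          rw [← mul_assoc, ← Real.exp_add, add_neg_cancel, Real.exp_zero, one_mul]
        have hX : 0 < Real.exp (-u) * δ := mul_pos hcpos hδpos
        calc δ = Real.exp u * (Real.exp (-u) * δ) := this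
          _ ≤ (1 + θ) * (Real.exp (-u) * δ) := mul_le_mul_of_nonneg_right h1'.le hX.le
      have key := H (Real.exp (-u) * δ) δ (mul_pos hcpos hδpos) hle hδδ₀ hratio
      rw [abs_sub_comm]
      exact key.le
    · -- `δ < e^{-u} δ`
      have habs : |u| = -u := abs_of_neg hu0
      have hle : δ ≤ Real.exp (-u) * δ := by
        have : 1 ≤ Real.exp (-u) := by rw [Real.one_le_exp_iff]; linarith
        nlinarith
      have hlt : Real.exp (-u) * δ < δ₀ := by
        rw [habs] at hδlt
        calc Real.exp (-u) * δ < Real.exp (-u) * (δ₀ * Real.exp (-(-u))) := by gcongr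
          _ = δ₀ := by rw [neg_neg, mul_comm, mul_assoc, ← Real.exp_add, add_neg_cancel,
                Real.exp_zero, mul_one]
      have hratio : Real.exp (-u) * δ ≤ (1 + θ) * δ := by
        have h1' : Real.exp (-u) < 1 + θ := by rw [habs] at hexpu; exact hexpu
        nlinarith
      have key := H δ (Real.exp (-u) * δ) hδpos hle hlt hratio
      exact key.le
  have hle : Filter.map (fun δ : ℝ =>
      (bondDomainCrossingProb R (Real.exp (-u) * δ), bondDomainCrossingProb R δ))
        (nhdsWithin (0 : ℝ) (Set.Ioi 0)) ≤ 𝓟 {q : ℝ × ℝ | |q.1 - q.2| ≤ ε} := by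
    rw [Filter.le_principal_iff, Filter.mem_map]
    exact hev_mem
  have h3 : ClusterPt (ev g) (𝓟 {q : ℝ × ℝ | |q.1 - q.2| ≤ ε}) := ClusterPt.mono h1 hle
  rw [← mem_closure_iff_clusterPt, hD.closure_eq] at h3
  exact h3

/-! ### The flow -/

/-- The scale action restricted to `Λ'`, as a map `ℝ → Λ' → Λ'`. [folklore] -/
def scaleActOn (s : ℝ) (g : ↥clusterSet) : ↥clusterSet :=
  ⟨scaleAct s (g : ConformalRectangle → ℝ), scaleAct_mem_clusterSet g.2 s⟩

/-- Coordinates of the restricted action. [folklore] -/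
@[simp] theorem coe_scaleActOn (s : ℝ) (g : ↥clusterSet) :
    ((scaleActOn s g : ↥clusterSet) : ConformalRectangle → ℝ) = scaleAct s g := rfl

/-- **Joint continuity** of `(s, g) ↦ scaleAct s g` on `ℝ × Λ'`. [cite: SchrammSmirnov2011, §1] -/
theorem continuous_scaleActOn : Continuous (Function.uncurry scaleActOn) := by
  refine continuous_induced_rng.2 ?_
  refine continuous_pi fun R => ?_
  -- the coordinate `R` : `(s, g) ↦ g (R.map (dilation s))`
  refine continuous_iff_continuousAt.2 fun z₀ => ?_
  obtain ⟨s₀, g₀⟩ := z₀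
  rw [ContinuousAt, Metric.tendsto_nhds]
  intro ε hε
  -- equicontinuity at the rectangle `R.map (dilation s₀)`
  obtain ⟨η, hη, hequi⟩ := clusterSet_equicontinuous (R.map (dilation s₀)) (half_pos hε)
  -- nearby times
  have hs : ∀ᶠ s in 𝓝 s₀, |s - s₀| < η := by
    have : Set.Ioo (s₀ - η) (s₀ + η) ∈ 𝓝 s₀ := Ioo_mem_nhds (by linarith) (by linarith)
    filter_upwards [this] with s hs
    rw [abs_lt]; constructor <;> linarith [hs.1, hs.2]
  -- nearby cluster points, at the one coordinate `R.map (dilation s₀)`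
  have hg : ∀ᶠ g : ↥clusterSet in 𝓝 g₀, dist ((g : ConformalRectangle → ℝ) (R.map (dilation s₀)))
      ((g₀ : ConformalRectangle → ℝ) (R.map (dilation s₀))) < ε / 2 := by
    have hc : Continuous fun g : ↥clusterSet => (g : ConformalRectangle → ℝ) (R.map (dilation s₀)) :=
      (continuous_apply (R.map (dilation s₀))).comp continuous_subtype_val
    exact Metric.tendsto_nhds.1 (hc.tendsto g₀) (ε / 2) (half_pos hε)
  have hprod := hs.prod_nhds hg
  filter_upwards [hprod] with z hz
  obtain ⟨hz1, hz2⟩ := hz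
  show dist (scaleAct z.1 (z.2 : ConformalRectangle → ℝ) R) (scaleAct s₀ (g₀ : ConformalRectangle → ℝ) R) < ε
  simp only [scaleAct]
  -- `R.map (dilation z.1) = (R.map (dilation s₀)).map (dilation (z.1 - s₀))`
  have hR : R.map (dilation z.1) = (R.map (dilation s₀)).map (dilation (z.1 - s₀)) := by
    rw [map_dilation_map_dilation, sub_add_cancel]
  rw [hR]
  have h1 := hequi (z.2 : ConformalRectangle → ℝ) z.2.2 (z.1 - s₀) hz1
  rw [Real.dist_eq] at hz2 ⊢
  calc |(z.2 : ConformalRectangle → ℝ) ((R.map (dilation s₀)).map (dilation (z.1 - s₀))) -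
        (g₀ : ConformalRectangle → ℝ) (R.map (dilation s₀))|
      ≤ |(z.2 : ConformalRectangle → ℝ) ((R.map (dilation s₀)).map (dilation (z.1 - s₀))) -
          (z.2 : ConformalRectangle → ℝ) (R.map (dilation s₀))| +
        |(z.2 : ConformalRectangle → ℝ) (R.map (dilation s₀)) -
          (g₀ : ConformalRectangle → ℝ) (R.map (dilation s₀))| := abs_sub_le _ _ _
    _ < ε / 2 + ε / 2 := add_lt_add_of_le_of_lt h1 hz2
    _ = ε := add_halves ε

/-- The dilation flow on `Λ'`. [cite: SchrammSmirnov2011, §1] -/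
def dilationFlow : Flow ℝ ↥clusterSet where
  toFun := scaleActOn
  cont' := continuous_scaleActOn
  map_add' s t g := Subtype.ext (by
    simp only [coe_scaleActOn]
    exact scaleAct_add s t _)
  map_zero' g := Subtype.ext (by
    simp only [coe_scaleActOn]
    exact scaleAct_zero _)

/-- **Stub A** (registered stub `stub_dilationFlow` of line `dilation-dynamics`, verbatim): the
scale action restricts to a jointly continuous real flow on the cluster set, acting in
coordinates by `(Φ s g) R = g (R.map (dilation s))`. [cite: SchrammSmirnov2011, §1] -/
theorem stub_dilationFlow :
    ∃ Φ : Flow ℝ ↥clusterSet, ∀ (s : ℝ) (g : ↥clusterSet) (R : ConformalRectangle),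
      (Φ s g : ConformalRectangle → ℝ) R = (g : ConformalRectangle → ℝ) (R.map (dilation s)) :=
  ⟨dilationFlow, fun _ _ _ => rfl⟩

end Summit.CriticalPhenomena.CardyFormulaZ2.Theorems.CardyShadowIsolated.DilationDynamics

end
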